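import Literature.NumberTheory.EllipticCurves.PointCountEulerCriterion

/-!
# Frobenius (isogeny-character) certificates for Kenku's composite levels — table `X₀(11)` (`j = -2¹⁵, -11², -11·131³`)

Topic `NumberTheory/EllipticCurves`; theorems only (kernel-decided data: no definition, no named fact,
no `native_decide`). Context: the composite levels `N` of Kenku's theorem (no elliptic curve over `ℚ`
has a `ℚ`-rational cyclic `N`-isogeny for the 84 minimal levels outside the list
`{1, …, 19, 21, 25, 27, 37, 43, 67, 163}`; Kenku 1982, Silverman *AEC* IX.6 Ex. 6.4; tree:
`kenku_minimalLevels_mem_kenkuDegrees`, and the 73-element barrier set of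
`Summit.ABC.ABC.Theorems.stub_radius_of_mazur_of_barrier`) that contain a prime
`p ∈ {11, 17, 19, 37, 43, 67, 163}` reduce to the finite table `X₀(p)(ℚ) ∖ cusps` (Mazur 1978, Thm. 1 and
the table on p. 129: `ν(p) = 3, 2, 1, 2, 1, 1, 1` non-cuspidal points) plus, for `N = p·q`
(`q ∈ {2, 3, 5, 7, 13}`) resp. `N = p²`, the absence of a rational `q`-isogeny resp. of a rational cyclic
`p²`-isogeny on the curves of the table. By Mazur 1978, Prop. 6.3 (1) (tree theorem
`Mazur1978.isogenyCharacter_sq_sub_frobeniusTrace_mul_add_eq_zero`) the isogeny character `r` of a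
rational `q`-isogeny satisfies `r(φ_ℓ)² - a_ℓ r(φ_ℓ) + ℓ = 0` in `𝔽_q` at every good prime `ℓ ≠ q`; the
same Manin-relation argument for a `Γ_ℚ`-stable cyclic subgroup of order `p²` gives a root of
`X² - a_ℓX + ℓ` in `ℤ/p²`. This file records, for each curve `E_j` of table `X₀(11)` (`j = -2¹⁵, -11², -11·131³`) (`j` as listed; the
model is the minimal quadratic twist of the `ℚ`-curve with that `j`, an integral globally minimal
model) and each witness prime `ℓ`:

* `card_<E>_<ℓ>` : `#Ẽ_j(𝔽_ℓ) = n` — so `a_ℓ = ℓ + 1 - n` — on `E.map (Int.castRingHom (ZMod ℓ))`, the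
  shape of `Literature.NumberTheory.Automorphic.numPointsMod` / `WeierstrassCurve.reductionPointCount`
  (kernel `decide` through `WeierstrassCurve.natCard_point_eq_one_add_card` and, for odd `ℓ`,
  `card_sol_eq_sum_euler`);
* `noroot_<E>_<ℓ>_<m>` : `X² - a_ℓX + ℓ` has no root in `ZMod m` (`m = q` or `m = p²`), by `decide`.

Hence (given the table) no curve of the table — so no elliptic curve over `ℚ` — has a rational cyclic
isogeny of degree `p·q` resp. `p²` for the levels named in the docstrings. Twisting does not matter:
a quadratic twist changes `a_ℓ` by a sign, and rational cyclic subgroups correspond under twists.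
Data generated by the certified-compute seat of crux stmt-ABC-15193 (`MazurKenkuRadius`), job
`ccert-ABC-15193-barrier73` (pure Python; models by the Laska–Kraus–Connell algorithm; point counts
naive), and RE-VERIFIED HERE BY THE KERNEL, which is the only thing these theorems rely on.

## References

* B. Mazur, *Rational isogenies of prime degree*, Invent. Math. 44 (1978) 129–162: Thm. 1, table
  p. 129, Prop. 6.3 (1). [Mazur1978]
* M. A. Kenku, *On the number of ℚ-isomorphism classes of elliptic curves in each ℚ-isogeny class*,
  J. Number Theory 15 (1982) 199–202. [Kenku1982]
* J. H. Silverman, *The Arithmetic of Elliptic Curves*, 2nd ed. (2009), IX.6 Example 6.4. [SilvermanAEC2009]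
-/

namespace Literature.NumberTheory.EllipticCurves.KenkuLevelsCert

open Literature.NumberTheory.EllipticCurves

/-- `#Ẽ(𝔽_2) = 2`, i.e. `a_2 = 1`, for `E = [1, 1, 0, -2, -7]` (`j = -121`; table `X₀(11)`,
minimal discriminant `-14641`); witness prime for the levels `33` = `11·3`, `55` = `11·5`. [folklore] -/
theorem card_E11_jm121_2 :
    Nat.card (((⟨1, 1, 0, -2, -7⟩ : WeierstrassCurve ℤ).map (Int.castRingHom (ZMod 2))).toAffine.Point) = 2 := by
  rw [@WeierstrassCurve.natCard_point_eq_one_add_card (ZMod 2) (@ZMod.instField 2 ⟨by norm_num⟩) _ _ _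
    (by decide +kernel)]
  decide +kernel

/-- Level `33`: `X² - a_2X + 2 = X² - (1)X + 2` has no root modulo `3`
(no rational `3`-isogeny on (a twist of) `E_j`, hence no rational cyclic `33`-isogeny). [folklore] -/
theorem noroot_E11_jm121_2_3 : ∀ t : ZMod 3, t ^ 2 - (1 : ZMod 3) * t + 2 ≠ 0 := by
  decide +kernel

/-- Level `55`: `X² - a_2X + 2 = X² - (1)X + 2` has no root modulo `5`
(no rational `5`-isogeny on (a twist of) `E_j`, hence no rational cyclic `55`-isogeny). [folklore] -/
theorem noroot_E11_jm121_2_5 : ∀ t : ZMod 5, t ^ 2 - (1 : ZMod 5) * t + 2 ≠ 0 := by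
  decide +kernel

/-- `#Ẽ(𝔽_3) = 2`, i.e. `a_3 = 2`, for `E = [1, 1, 0, -2, -7]` (`j = -121`; table `X₀(11)`,
minimal discriminant `-14641`); witness prime for the levels `77` = `11·7`. [folklore] -/
theorem card_E11_jm121_3 :
    Nat.card (((⟨1, 1, 0, -2, -7⟩ : WeierstrassCurve ℤ).map (Int.castRingHom (ZMod 3))).toAffine.Point) = 2 := by
  rw [@WeierstrassCurve.natCard_point_eq_one_add_card (ZMod 3) (@ZMod.instField 3 ⟨by norm_num⟩) _ _ _
    (by decide +kernel), @card_sol_eq_sum_euler (ZMod 3) (@ZMod.instField 3 ⟨by norm_num⟩) _ _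
    (by rw [ZMod.ringChar_zmod_n]; decide), ZMod.card]
  decide +kernel

/-- Level `77`: `X² - a_3X + 3 = X² - (2)X + 3` has no root modulo `7`
(no rational `7`-isogeny on (a twist of) `E_j`, hence no rational cyclic `77`-isogeny). [folklore] -/
theorem noroot_E11_jm121_3_7 : ∀ t : ZMod 7, t ^ 2 - (2 : ZMod 7) * t + 3 ≠ 0 := by
  decide +kernel

/-- `#Ẽ(𝔽_5) = 5`, i.e. `a_5 = 1`, for `E = [1, 1, 0, -2, -7]` (`j = -121`; table `X₀(11)`,
minimal discriminant `-14641`); witness prime for the levels `22` = `11·2`. [folklore] -/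
theorem card_E11_jm121_5 :
    Nat.card (((⟨1, 1, 0, -2, -7⟩ : WeierstrassCurve ℤ).map (Int.castRingHom (ZMod 5))).toAffine.Point) = 5 := by
  rw [@WeierstrassCurve.natCard_point_eq_one_add_card (ZMod 5) (@ZMod.instField 5 ⟨by norm_num⟩) _ _ _
    (by decide +kernel), @card_sol_eq_sum_euler (ZMod 5) (@ZMod.instField 5 ⟨by norm_num⟩) _ _
    (by rw [ZMod.ringChar_zmod_n]; decide), ZMod.card]
  decide +kernel

/-- Level `22`: `X² - a_5X + 5 = X² - (1)X + 5` has no root modulo `2`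
(no rational `2`-isogeny on (a twist of) `E_j`, hence no rational cyclic `22`-isogeny). [folklore] -/
theorem noroot_E11_jm121_5_2 : ∀ t : ZMod 2, t ^ 2 - (1 : ZMod 2) * t + 5 ≠ 0 := by
  decide +kernel

/-- `#Ẽ(𝔽_23) = 22`, i.e. `a_23 = 2`, for `E = [1, 1, 0, -2, -7]` (`j = -121`; table `X₀(11)`,
minimal discriminant `-14641`); witness prime for the levels `121` = `11²`. [folklore] -/
theorem card_E11_jm121_23 :
    Nat.card (((⟨1, 1, 0, -2, -7⟩ : WeierstrassCurve ℤ).map (Int.castRingHom (ZMod 23))).toAffine.Point) = 22 := by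
  rw [@WeierstrassCurve.natCard_point_eq_one_add_card (ZMod 23) (@ZMod.instField 23 ⟨by norm_num⟩) _ _ _
    (by decide +kernel), @card_sol_eq_sum_euler (ZMod 23) (@ZMod.instField 23 ⟨by norm_num⟩) _ _
    (by rw [ZMod.ringChar_zmod_n]; decide), ZMod.card]
  decide +kernel

/-- Level `121`: `X² - a_23X + 23 = X² - (2)X + 23` has no root modulo `121`
(no `Γ_ℚ`-stable cyclic subgroup of order `121`, hence no rational cyclic `121`-isogeny). [folklore] -/
theorem noroot_E11_jm121_23_121 : ∀ t : ZMod 121, t ^ 2 - (2 : ZMod 121) * t + 23 ≠ 0 := by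
  decide +kernel

/-- `#Ẽ(𝔽_2) = 4`, i.e. `a_2 = -1`, for `E = [1, 1, 1, -30, -76]` (`j = -24729001`; table `X₀(11)`,
minimal discriminant `-121`); witness prime for the levels `33` = `11·3`, `55` = `11·5`. [folklore] -/
theorem card_E11_jm24729001_2 :
    Nat.card (((⟨1, 1, 1, -30, -76⟩ : WeierstrassCurve ℤ).map (Int.castRingHom (ZMod 2))).toAffine.Point) = 4 := by
  rw [@WeierstrassCurve.natCard_point_eq_one_add_card (ZMod 2) (@ZMod.instField 2 ⟨by norm_num⟩) _ _ _
    (by decide +kernel)]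
  decide +kernel

/-- Level `33`: `X² - a_2X + 2 = X² - (-1)X + 2` has no root modulo `3`
(no rational `3`-isogeny on (a twist of) `E_j`, hence no rational cyclic `33`-isogeny). [folklore] -/
theorem noroot_E11_jm24729001_2_3 : ∀ t : ZMod 3, t ^ 2 - (-1 : ZMod 3) * t + 2 ≠ 0 := by
  decide +kernel

/-- Level `55`: `X² - a_2X + 2 = X² - (-1)X + 2` has no root modulo `5`
(no rational `5`-isogeny on (a twist of) `E_j`, hence no rational cyclic `55`-isogeny). [folklore] -/
theorem noroot_E11_jm24729001_2_5 : ∀ t : ZMod 5, t ^ 2 - (-1 : ZMod 5) * t + 2 ≠ 0 := by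
  decide +kernel

/-- `#Ẽ(𝔽_3) = 2`, i.e. `a_3 = 2`, for `E = [1, 1, 1, -30, -76]` (`j = -24729001`; table `X₀(11)`,
minimal discriminant `-121`); witness prime for the levels `77` = `11·7`. [folklore] -/
theorem card_E11_jm24729001_3 :
    Nat.card (((⟨1, 1, 1, -30, -76⟩ : WeierstrassCurve ℤ).map (Int.castRingHom (ZMod 3))).toAffine.Point) = 2 := by
  rw [@WeierstrassCurve.natCard_point_eq_one_add_card (ZMod 3) (@ZMod.instField 3 ⟨by norm_num⟩) _ _ _
    (by decide +kernel), @card_sol_eq_sum_euler (ZMod 3) (@ZMod.instField 3 ⟨by norm_num⟩) _ _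
    (by rw [ZMod.ringChar_zmod_n]; decide), ZMod.card]
  decide +kernel

/-- Level `77`: `X² - a_3X + 3 = X² - (2)X + 3` has no root modulo `7`
(no rational `7`-isogeny on (a twist of) `E_j`, hence no rational cyclic `77`-isogeny). [folklore] -/
theorem noroot_E11_jm24729001_3_7 : ∀ t : ZMod 7, t ^ 2 - (2 : ZMod 7) * t + 3 ≠ 0 := by
  decide +kernel

/-- `#Ẽ(𝔽_5) = 5`, i.e. `a_5 = 1`, for `E = [1, 1, 1, -30, -76]` (`j = -24729001`; table `X₀(11)`,
minimal discriminant `-121`); witness prime for the levels `22` = `11·2`. [folklore] -/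
theorem card_E11_jm24729001_5 :
    Nat.card (((⟨1, 1, 1, -30, -76⟩ : WeierstrassCurve ℤ).map (Int.castRingHom (ZMod 5))).toAffine.Point) = 5 := by
  rw [@WeierstrassCurve.natCard_point_eq_one_add_card (ZMod 5) (@ZMod.instField 5 ⟨by norm_num⟩) _ _ _
    (by decide +kernel), @card_sol_eq_sum_euler (ZMod 5) (@ZMod.instField 5 ⟨by norm_num⟩) _ _
    (by rw [ZMod.ringChar_zmod_n]; decide), ZMod.card]
  decide +kernel

/-- Level `22`: `X² - a_5X + 5 = X² - (1)X + 5` has no root modulo `2`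
(no rational `2`-isogeny on (a twist of) `E_j`, hence no rational cyclic `22`-isogeny). [folklore] -/
theorem noroot_E11_jm24729001_5_2 : ∀ t : ZMod 2, t ^ 2 - (1 : ZMod 2) * t + 5 ≠ 0 := by
  decide +kernel

/-- `#Ẽ(𝔽_23) = 22`, i.e. `a_23 = 2`, for `E = [1, 1, 1, -30, -76]` (`j = -24729001`; table `X₀(11)`,
minimal discriminant `-121`); witness prime for the levels `121` = `11²`. [folklore] -/
theorem card_E11_jm24729001_23 :
    Nat.card (((⟨1, 1, 1, -30, -76⟩ : WeierstrassCurve ℤ).map (Int.castRingHom (ZMod 23))).toAffine.Point) = 22 := by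
  rw [@WeierstrassCurve.natCard_point_eq_one_add_card (ZMod 23) (@ZMod.instField 23 ⟨by norm_num⟩) _ _ _
    (by decide +kernel), @card_sol_eq_sum_euler (ZMod 23) (@ZMod.instField 23 ⟨by norm_num⟩) _ _
    (by rw [ZMod.ringChar_zmod_n]; decide), ZMod.card]
  decide +kernel

/-- Level `121`: `X² - a_23X + 23 = X² - (2)X + 23` has no root modulo `121`
(no `Γ_ℚ`-stable cyclic subgroup of order `121`, hence no rational cyclic `121`-isogeny). [folklore] -/
theorem noroot_E11_jm24729001_23_121 : ∀ t : ZMod 121, t ^ 2 - (2 : ZMod 121) * t + 23 ≠ 0 := by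
  decide +kernel

/-- `#Ẽ(𝔽_2) = 3`, i.e. `a_2 = 0`, for `E = [0, -1, 1, -7, 10]` (`j = -32768`, CM by discriminant `-11`; table `X₀(11)`,
minimal discriminant `-1331`); witness prime for the levels `55` = `11·5`, `77` = `11·7`. [folklore] -/
theorem card_E11_jm32768_2 :
    Nat.card (((⟨0, -1, 1, -7, 10⟩ : WeierstrassCurve ℤ).map (Int.castRingHom (ZMod 2))).toAffine.Point) = 3 := by
  rw [@WeierstrassCurve.natCard_point_eq_one_add_card (ZMod 2) (@ZMod.instField 2 ⟨by norm_num⟩) _ _ _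
    (by decide +kernel)]
  decide +kernel

/-- Level `55`: `X² - a_2X + 2 = X² - (0)X + 2` has no root modulo `5`
(no rational `5`-isogeny on (a twist of) `E_j`, hence no rational cyclic `55`-isogeny). [folklore] -/
theorem noroot_E11_jm32768_2_5 : ∀ t : ZMod 5, t ^ 2 - (0 : ZMod 5) * t + 2 ≠ 0 := by
  decide +kernel

/-- Level `77`: `X² - a_2X + 2 = X² - (0)X + 2` has no root modulo `7`
(no rational `7`-isogeny on (a twist of) `E_j`, hence no rational cyclic `77`-isogeny). [folklore] -/
theorem noroot_E11_jm32768_2_7 : ∀ t : ZMod 7, t ^ 2 - (0 : ZMod 7) * t + 2 ≠ 0 := by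
  decide +kernel

/-- `#Ẽ(𝔽_3) = 5`, i.e. `a_3 = -1`, for `E = [0, -1, 1, -7, 10]` (`j = -32768`, CM by discriminant `-11`; table `X₀(11)`,
minimal discriminant `-1331`); witness prime for the levels `22` = `11·2`, `121` = `11²`. [folklore] -/
theorem card_E11_jm32768_3 :
    Nat.card (((⟨0, -1, 1, -7, 10⟩ : WeierstrassCurve ℤ).map (Int.castRingHom (ZMod 3))).toAffine.Point) = 5 := by
  rw [@WeierstrassCurve.natCard_point_eq_one_add_card (ZMod 3) (@ZMod.instField 3 ⟨by norm_num⟩) _ _ _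
    (by decide +kernel), @card_sol_eq_sum_euler (ZMod 3) (@ZMod.instField 3 ⟨by norm_num⟩) _ _
    (by rw [ZMod.ringChar_zmod_n]; decide), ZMod.card]
  decide +kernel

/-- Level `22`: `X² - a_3X + 3 = X² - (-1)X + 3` has no root modulo `2`
(no rational `2`-isogeny on (a twist of) `E_j`, hence no rational cyclic `22`-isogeny). [folklore] -/
theorem noroot_E11_jm32768_3_2 : ∀ t : ZMod 2, t ^ 2 - (-1 : ZMod 2) * t + 3 ≠ 0 := by
  decide +kernel

/-- Level `121`: `X² - a_3X + 3 = X² - (-1)X + 3` has no root modulo `121`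
(no `Γ_ℚ`-stable cyclic subgroup of order `121`, hence no rational cyclic `121`-isogeny). [folklore] -/
theorem noroot_E11_jm32768_3_121 : ∀ t : ZMod 121, t ^ 2 - (-1 : ZMod 121) * t + 3 ≠ 0 := by
  decide +kernel

/-- `#Ẽ(𝔽_7) = 8`, i.e. `a_7 = 0`, for `E = [0, -1, 1, -7, 10]` (`j = -32768`, CM by discriminant `-11`; table `X₀(11)`,
minimal discriminant `-1331`); witness prime for the levels `33` = `11·3`. [folklore] -/
theorem card_E11_jm32768_7 :
    Nat.card (((⟨0, -1, 1, -7, 10⟩ : WeierstrassCurve ℤ).map (Int.castRingHom (ZMod 7))).toAffine.Point) = 8 := by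
  rw [@WeierstrassCurve.natCard_point_eq_one_add_card (ZMod 7) (@ZMod.instField 7 ⟨by norm_num⟩) _ _ _
    (by decide +kernel), @card_sol_eq_sum_euler (ZMod 7) (@ZMod.instField 7 ⟨by norm_num⟩) _ _
    (by rw [ZMod.ringChar_zmod_n]; decide), ZMod.card]
  decide +kernel

/-- Level `33`: `X² - a_7X + 7 = X² - (0)X + 7` has no root modulo `3`
(no rational `3`-isogeny on (a twist of) `E_j`, hence no rational cyclic `33`-isogeny). [folklore] -/
theorem noroot_E11_jm32768_7_3 : ∀ t : ZMod 3, t ^ 2 - (0 : ZMod 3) * t + 7 ≠ 0 := by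
  decide +kernel

end Literature.NumberTheory.EllipticCurves.KenkuLevelsCert
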